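import Literature.NumberTheory.LFunctions.SelbergClassProofs
import Literature.Analysis.SpecialFunctions.GammaProductBounds
import Mathlib.Analysis.Calculus.Deriv.Star
import HarnessLib

/-!
# The Selberg class in degree `< 1`: growth of `F` on vertical lines from the functional equation

Sibling proofs file (D-0014 append protocol) for
`Literature/NumberTheory/LFunctions/SelbergClass.lean`, first half of the discharge of the named
fact `Literature.NumberTheory.LFunctions.SelbergDatum.degree_eq_zero_of_lt_one` ("there is no
element of the Selberg class of degree `0 < d < 1`", Richert 1957, Bochner 1958, Conrey–Ghosh 1993;
completed in `SelbergClassDegreeProofs.lean`). Everything here is PROVED; no definitions.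

* `fe_prod_inv_Gamma_of_ne` — the functional equation in the pole-free form
  `Q^s P†(1−s) F(s) = ω Q^{1−s} P(s) conj F(1 − s̄)` (`P(s) = ∏ⱼ Γ(λⱼs+μⱼ)⁻¹`,
  `P†(w) = ∏ⱼ Γ(λⱼw + conj μⱼ)⁻¹`) for ALL `s ∉ {0, 1}` (the tree's
  `SelbergDatum.fe_prod_inv_Gamma` gives it on the open strip; both sides times
  `(s−1)^m (−s)^m` are entire, so the identity theorem applies).
* `norm_toFun_eq_of_re_lt_one` — hence for `re s < 1`, `s ≠ 0`:
  `‖F(s)‖ = Q^{1−2σ} ∏ⱼ ‖Γ(λⱼ(1−s) + conj μⱼ)‖ · ‖Γ(λⱼ s + μⱼ)⁻¹‖ · ‖F(1 − s̄)‖`.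
* `exists_norm_toFun_left_le` — **growth on far-left lines, uniformly in the line**: if
  `d = 2∑λⱼ < 1` then for `k ≥ k₀` and all real `t`,
  `‖F(−k − 1/2 + it)‖ ≤ A₀ (Q²)^{k+1} (120π²)^N (k + M + |t|)^{d(k+1) + 2N}`
  (`N` the number of gamma factors), from the crude Stirling bounds of
  `Literature/Analysis/SpecialFunctions/GammaProductBounds.lean` — the exponentials
  `e^{∓π|u|/2}` of numerator and denominator cancel exactly because `λⱼ(1−s) + conj μⱼ` and
  `λⱼ s + μⱼ` have opposite imaginary parts.
* `exists_norm_toFun_quarter_ge` — **growth on `re s = 1/4` from below**: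
  `‖F(1/4 + it)‖ ≥ R (1 + (λ₀t + im μ₀)²/x₀²)^{λ₀/4} ‖F(3/4 + it)‖` with `R > 0`,
  `x₀ = λ₀/4 + re μ₀` (log-convexity lower bound `norm_Gamma_shift_ge`).

## References

* J. B. Conrey, A. Ghosh, *On the Selberg class of Dirichlet series: small degrees*, Duke Math. J.
  **72** (1993), 673–693. [ConreyGhosh1993]
* J. Steuding, *Value-Distribution of L-Functions*, LNM 1877 (2007), Thm. 6.1 (sketch of the
  Conrey–Ghosh argument). [Steuding2007]
-/

noncomputable section

open Complex Filter Topology Set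
open scoped ComplexConjugate

namespace Literature.NumberTheory.LFunctions

namespace SelbergDatum

open Literature.Analysis.SpecialFunctions

variable (D : SelbergDatum)

/-! ## The functional equation off the strip -/

/-- `s ↦ conj (G (1 − conj s))` is entire when `G` is. [folklore] -/
lemma differentiable_conj_comp_one_sub_conj {G : ℂ → ℂ} (hG : Differentiable ℂ G) :
    Differentiable ℂ fun s : ℂ ↦ conj (G (1 - conj s)) := by
  intro s
  have h : DifferentiableAt ℂ (fun z : ℂ ↦ G (1 - z)) (conj s) :=
    (hG.comp ((differentiable_const _).sub differentiable_id)).differentiableAt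
  have := (differentiableAt_conj_conj_iff (f := fun z : ℂ ↦ G (1 - z)) (x := s)).2 h
  exact this

/-- **The functional equation in pole-free form, on all of `ℂ ∖ {0, 1}`**:
`Q^s P†(1−s) F(s) = ω Q^{1−s} P(s) conj F(1 − s̄)` with `P(s) = ∏ⱼ Γ(λⱼ s + μⱼ)⁻¹`,
`P†(w) = ∏ⱼ Γ(λⱼ w + conj μⱼ)⁻¹`. On the open strip this is the tree's `fe_prod_inv_Gamma`
(Selberg's axiom (iii)); multiplied by `(s−1)^m(−s)^m` both sides become entire (`(s−1)^m F(s)`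
and `(−s)^m conj F(1−s̄) = conj((1−s̄−1)^m F(1−s̄))` are entire by axiom (ii)), so the identity
extends by the identity theorem. [cite: Selberg1992, axiom (iii)] -/
theorem fe_prod_inv_Gamma_of_ne (s : ℂ) (h0 : s ≠ 0) (h1 : s ≠ 1) :
    (D.Q : ℂ) ^ s * (∏ j, (Gamma (D.lam j * (1 - s) + conj (D.mu j)))⁻¹) * D.toFun s =
      D.rootNumber * (D.Q : ℂ) ^ (1 - s) * (∏ j, (Gamma (D.lam j * s + D.mu j))⁻¹) *
        conj (D.toFun (1 - conj s)) := by
  obtain ⟨G, hG, hGF⟩ := D.differentiable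
  -- the two entire functions
  set Λ₁ : ℂ → ℂ := fun s ↦ (D.Q : ℂ) ^ s * (∏ j, (Gamma (D.lam j * (1 - s) + conj (D.mu j)))⁻¹) *
    G s * (-s) ^ D.polarOrder with hΛ₁
  set Λ₂ : ℂ → ℂ := fun s ↦ D.rootNumber * (D.Q : ℂ) ^ (1 - s) *
    (∏ j, (Gamma (D.lam j * s + D.mu j))⁻¹) * conj (G (1 - conj s)) * (s - 1) ^ D.polarOrder
    with hΛ₂
  have hΛ₁d : Differentiable ℂ Λ₁ := by
    refine ((Differentiable.mul ?_ ?_).mul hG).mul (differentiable_id.neg.pow _)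
    · exact differentiable_id.const_cpow (Or.inl D.Q_ne_zero)
    · exact (differentiable_prod_inv_Gamma D.lam fun j ↦ conj (D.mu j)).comp
        ((differentiable_const _).sub differentiable_id)
  have hΛ₂d : Differentiable ℂ Λ₂ := by
    refine (((Differentiable.mul ?_ ?_).mul (differentiable_prod_inv_Gamma D.lam D.mu)).mul
      (differentiable_conj_comp_one_sub_conj hG)).mul ((differentiable_id.sub_const 1).pow _)
    · exact differentiable_const _
    · exact ((differentiable_const _).sub differentiable_id).const_cpow (Or.inl D.Q_ne_zero)
  -- `conj (G (1 - conj s)) = (-s)^m conj F(1 - conj s)` for `s ≠ 0`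
  have hGconj : ∀ s : ℂ, s ≠ 0 →
      conj (G (1 - conj s)) = (-s) ^ D.polarOrder * conj (D.toFun (1 - conj s)) := by
    intro s hs
    have hne : 1 - conj s ≠ 1 := by
      intro h; apply hs
      have : conj s = 0 := by linear_combination -h
      simpa using congrArg conj this
    rw [hGF _ hne, map_mul, map_pow]
    congr 2
    simp
  -- they agree on the open strip
  have hstrip : ∀ s : ℂ, 0 < s.re → s.re < 1 → Λ₁ s = Λ₂ s := by
    intro s hs0 hs1
    have hs : s ≠ 0 := fun h ↦ by rw [h, Complex.zero_re] at hs0; exact lt_irrefl _ hs0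
    have hs' : s ≠ 1 := fun h ↦ by rw [h, Complex.one_re] at hs1; exact lt_irrefl _ hs1
    have hfe := D.fe_prod_inv_Gamma s hs0 hs1
    simp only [hΛ₁, hΛ₂, hGF s hs', hGconj s hs]
    linear_combination ((s - 1) ^ D.polarOrder * (-s) ^ D.polarOrder) * hfe
  -- identity theorem
  have hall : Λ₁ = Λ₂ := by
    have hΦd : Differentiable ℂ (Λ₁ - Λ₂) := hΛ₁d.sub hΛ₂d
    have hopen : IsOpen (Complex.re ⁻¹' Set.Ioo (0 : ℝ) 1) :=
      isOpen_Ioo.preimage Complex.continuous_re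
    have hmem : (((1 / 2 : ℝ) : ℂ)) ∈ Complex.re ⁻¹' Set.Ioo (0 : ℝ) 1 := by
      simp only [Set.mem_preimage, Complex.ofReal_re, Set.mem_Ioo]; norm_num
    have key : (Λ₁ - Λ₂) =ᶠ[𝓝 (((1 / 2 : ℝ) : ℂ))] 0 := by
      filter_upwards [hopen.mem_nhds hmem] with s hs
      have hs' : 0 < s.re ∧ s.re < 1 := hs
      simp only [Pi.sub_apply, Pi.zero_apply, hstrip s hs'.1 hs'.2, sub_self]
    have h0 : Λ₁ - Λ₂ = 0 := funext fun z ↦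
      (Complex.analyticOnNhd_univ_iff_differentiable.mpr hΦd).eqOn_zero_of_preconnected_of_eventuallyEq_zero
        isPreconnected_univ (mem_univ _) key (mem_univ z)
    exact sub_eq_zero.1 h0
  -- evaluate at `s`
  have h := congrFun hall s
  simp only [hΛ₁, hΛ₂, hGF s h1, hGconj s h0] at h
  have hne : (s - 1) ^ D.polarOrder * (-s) ^ D.polarOrder ≠ 0 :=
    mul_ne_zero (pow_ne_zero _ (sub_ne_zero.2 h1)) (pow_ne_zero _ (neg_ne_zero.2 h0))
  have h2 : ((D.Q : ℂ) ^ s * (∏ j, (Gamma (D.lam j * (1 - s) + conj (D.mu j)))⁻¹) * D.toFun s -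
      D.rootNumber * (D.Q : ℂ) ^ (1 - s) * (∏ j, (Gamma (D.lam j * s + D.mu j))⁻¹) *
        conj (D.toFun (1 - conj s))) * ((s - 1) ^ D.polarOrder * (-s) ^ D.polarOrder) = 0 := by
    linear_combination h
  exact sub_eq_zero.1 ((mul_eq_zero.1 h2).resolve_right hne)

/-- **`‖F(s)‖` on `re s < 1` from the functional equation**: for `re s < 1`, `s ≠ 0`,
`‖F(s)‖ = Q^{1−2σ} · ∏ⱼ (‖Γ(λⱼ(1−s) + conj μⱼ)‖ · ‖Γ(λⱼs + μⱼ)⁻¹‖) · ‖F(1 − s̄)‖`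
(`P†(1−s) ≠ 0` there; `‖ω‖ = 1`, `‖Q^s‖ = Q^σ`). [cite: Selberg1992, axiom (iii)] -/
theorem norm_toFun_eq_of_re_lt_one (s : ℂ) (h0 : s ≠ 0) (hs : s.re < 1) :
    ‖D.toFun s‖ = D.Q ^ (1 - 2 * s.re) *
      (∏ j, (‖Gamma (D.lam j * (1 - s) + conj (D.mu j))‖ * ‖(Gamma (D.lam j * s + D.mu j))⁻¹‖)) *
        ‖D.toFun (1 - conj s)‖ := by
  have h1 : s ≠ 1 := fun h ↦ by rw [h, Complex.one_re] at hs; exact lt_irrefl _ hs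
  have hfe := D.fe_prod_inv_Gamma_of_ne s h0 h1
  have hA : (D.Q : ℂ) ^ s ≠ 0 := Complex.cpow_ne_zero_iff.2 (Or.inl D.Q_ne_zero)
  have hΓ : ∀ j, Gamma (D.lam j * (1 - s) + conj (D.mu j)) ≠ 0 :=
    D.Gamma_lam_mul_one_sub_add_conj_mu_ne_zero s hs
  have hPd : ∏ j, (Gamma (D.lam j * (1 - s) + conj (D.mu j)))⁻¹ ≠ 0 :=
    prod_inv_Gamma_ne_zero D.lam (fun j ↦ conj (D.mu j)) (1 - s) hΓ
  have hF : D.toFun s = D.rootNumber * (D.Q : ℂ) ^ (1 - s) *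
      (∏ j, (Gamma (D.lam j * s + D.mu j))⁻¹) * conj (D.toFun (1 - conj s)) /
        ((D.Q : ℂ) ^ s * ∏ j, (Gamma (D.lam j * (1 - s) + conj (D.mu j)))⁻¹) := by
    rw [eq_div_iff (mul_ne_zero hA hPd)]
    linear_combination hfe
  rw [hF, norm_div, norm_mul, norm_mul, norm_mul, norm_mul, D.norm_rootNumber, one_mul,
    Complex.norm_conj, Complex.norm_cpow_eq_rpow_re_of_pos D.Q_pos,
    Complex.norm_cpow_eq_rpow_re_of_pos D.Q_pos, norm_prod, norm_prod, Finset.prod_mul_distrib]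
  simp only [sub_re, one_re, norm_inv]
  have hpos : ∀ j, 0 < ‖Gamma (D.lam j * (1 - s) + conj (D.mu j))‖ := fun j ↦ norm_pos_iff.2 (hΓ j)
  have hPn : (∏ j, ‖Gamma (D.lam j * (1 - s) + conj (D.mu j))‖) ≠ 0 :=
    (Finset.prod_pos fun j _ ↦ hpos j).ne'
  have hQ : (D.Q ^ s.re : ℝ) ≠ 0 := (Real.rpow_pos_of_pos D.Q_pos _).ne'
  rw [Finset.prod_inv_distrib (fun j ↦ ‖Gamma (D.lam j * (1 - s) + conj (D.mu j))‖),
    show (1 : ℝ) - 2 * s.re = (1 - s.re) - s.re by ring, Real.rpow_sub D.Q_pos (1 - s.re) s.re]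
  generalize D.Q ^ s.re = q at hQ ⊢
  generalize D.Q ^ (1 - s.re) = q'
  generalize (∏ j, ‖Gamma (D.lam j * (1 - s) + conj (D.mu j))‖) = Pn at hPn ⊢
  generalize (∏ j, ‖Gamma (D.lam j * s + D.mu j)‖⁻¹) = Pd
  generalize ‖D.toFun (1 - conj s)‖ = f
  field_simp

/-! ## Growth on far-left vertical lines -/

/-- `im (λ s + μ) = λ im s + im μ` for real `λ` (companion of `re_lam_mul_add`). [folklore] -/
lemma im_lam_mul_add (l : ℝ) (m s : ℂ) : ((l : ℂ) * s + m).im = l * s.im + m.im := by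
  simp [Complex.mul_im]

/-- `λⱼ ≤ d/2`: each `λⱼ` is at most half the degree. [folklore] -/
lemma lam_le_degree_div_two (j : Fin D.numGamma) : D.lam j ≤ D.degree / 2 := by
  have h : D.lam j ≤ ∑ i, D.lam i :=
    Finset.single_le_sum (f := D.lam) (fun i _ ↦ (D.lam_pos i).le) (Finset.mem_univ j)
  simp only [degree]; linarith

/-- `F` is bounded on `re s ≥ 3/2` by `A₀ = ∑ |a(n)| n^{−3/2}` (absolute convergence). [folklore] -/
lemma norm_toFun_le_tsum (s : ℂ) (hs : 3 / 2 ≤ s.re) :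
    ‖D.toFun s‖ ≤ ∑' n : ℕ, ‖LSeries.term D.coeff ((3 / 2 : ℝ) : ℂ) n‖ := by
  have h1 : 1 < s.re := by linarith
  have hsum : LSeriesSummable D.coeff ((3 / 2 : ℝ) : ℂ) := D.LSeriesSummable_coeff _ (by simp; norm_num)
  have hnorm : Summable fun n ↦ ‖LSeries.term D.coeff ((3 / 2 : ℝ) : ℂ) n‖ := summable_norm_iff.2 hsum
  have hle : ∀ n, ‖LSeries.term D.coeff s n‖ ≤ ‖LSeries.term D.coeff ((3 / 2 : ℝ) : ℂ) n‖ :=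
    fun n ↦ LSeries.norm_term_le_of_re_le_re D.coeff (by simpa using hs) n
  have hnorm' : Summable fun n ↦ ‖LSeries.term D.coeff s n‖ :=
    .of_nonneg_of_le (fun n ↦ norm_nonneg _) hle hnorm
  rw [D.eqOn_LSeries h1, LSeries]
  exact (norm_tsum_le_tsum_norm hnorm').trans (Summable.tsum_le_tsum hle hnorm' hnorm)

set_option maxHeartbeats 400000 in
/-- **Growth of `F` on the lines `re s = −k − 1/2`, uniformly in `k`** (for `d < 1`): there are
`M ≥ 1`, `A₀ > 0`, `k₀` such that for all `k ≥ k₀` and all real `t`,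
`‖F(−k − 1/2 + it)‖ ≤ A₀ (Q²)^{k+1} (120π²)^N (k + M + |t|)^{d(k+1) + 2N}`, `N` the number of gamma
factors. From `norm_toFun_eq_of_re_lt_one` and the uniform Gamma-ratio bound
`Literature.Analysis.SpecialFunctions.norm_Gamma_mul_norm_inv_Gamma_le`: with
`u = λⱼt + im μⱼ`, `‖Γ(λⱼ(1−s) + conj μⱼ)‖ = ‖Γ(Xⱼ + iu)‖`, `λⱼ s + μⱼ = Yⱼ + iu`,
`Xⱼ − Yⱼ = λⱼ(2k+2)`, and `∑ⱼ λⱼ(2k+2) = d(k+1)`. (This replaces Stirling's formula, which would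
give the exponent `d(k+1)` exactly.) [cite: ConreyGhosh1993, §2] -/
theorem exists_norm_toFun_left_le (hd : D.degree < 1) :
    ∃ (M A₀ : ℝ) (k₀ : ℕ), 1 ≤ M ∧ 0 < A₀ ∧ ∀ k : ℕ, k₀ ≤ k → ∀ t : ℝ,
      ‖D.toFun (((-(k : ℝ) - 1 / 2 : ℝ) : ℂ) + t * I)‖ ≤
        A₀ * (D.Q ^ 2) ^ (k + 1) * (120 * Real.pi ^ 2) ^ D.numGamma *
          ((k : ℝ) + M + |t|) ^ (D.degree * (k + 1) + 2 * D.numGamma) := by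
  -- constants
  obtain ⟨Sμ, hSμ⟩ : ∃ S : ℝ, ∑ j, ‖D.mu j‖ = S := ⟨_, rfl⟩
  have hSμ0 : 0 ≤ Sμ := by rw [← hSμ]; exact Finset.sum_nonneg fun j _ ↦ norm_nonneg _
  have hmuS : ∀ j, ‖D.mu j‖ ≤ Sμ := fun j ↦ by
    rw [← hSμ]
    exact Finset.single_le_sum (f := fun i ↦ ‖D.mu i‖) (fun i _ ↦ norm_nonneg _) (Finset.mem_univ j)
  obtain ⟨A₀, hA₀⟩ : ∃ A : ℝ, (∑' n : ℕ, ‖LSeries.term D.coeff ((3 / 2 : ℝ) : ℂ) n‖) + 1 = A := ⟨_, rfl⟩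
  have hA₀pos : 0 < A₀ := by
    have : 0 ≤ ∑' n : ℕ, ‖LSeries.term D.coeff ((3 / 2 : ℝ) : ℂ) n‖ := tsum_nonneg fun n ↦ norm_nonneg _
    rw [← hA₀]; linarith
  have hFA₀ : ∀ s : ℂ, 3 / 2 ≤ s.re → ‖D.toFun s‖ ≤ A₀ := fun s hs ↦
    (D.norm_toFun_le_tsum s hs).trans (by rw [← hA₀]; linarith)
  have hlam1 : ∀ j, D.lam j ≤ 1 / 2 := fun j ↦ (D.lam_le_degree_div_two j).trans (by linarith)
  refine ⟨3 * Sμ + 4, A₀, ∑ j, ⌈(1 + (D.mu j).re) / D.lam j⌉₊, by linarith, hA₀pos, fun k hk t ↦ ?_⟩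
  -- the line
  have hk0 : (0 : ℝ) ≤ k := k.cast_nonneg
  set σ : ℝ := -(k : ℝ) - 1 / 2 with hσ
  set s : ℂ := (σ : ℂ) + t * I with hs
  have hsre : s.re = σ := by simp [hs]
  have hsim : s.im = t := by simp [hs]
  have hs0 : s ≠ 0 := fun h ↦ by
    have := congrArg Complex.re h; rw [hsre, Complex.zero_re, hσ] at this; linarith
  have hs1 : s.re < 1 := by rw [hsre, hσ]; linarith
  -- `k` is large for every `j`
  have hkj : ∀ j, 1 + (D.mu j).re ≤ D.lam j * k := by
    intro j
    have h1 : ⌈(1 + (D.mu j).re) / D.lam j⌉₊ ≤ k := le_trans (Finset.single_le_sum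
      (f := fun i ↦ ⌈(1 + (D.mu i).re) / D.lam i⌉₊) (fun i _ ↦ Nat.zero_le _) (Finset.mem_univ j)) hk
    have h2 : (1 + (D.mu j).re) / D.lam j ≤ k := (Nat.le_ceil _).trans (by exact_mod_cast h1)
    rwa [div_le_iff₀ (D.lam_pos j), mul_comm] at h2
  -- the norm formula
  rw [D.norm_toFun_eq_of_re_lt_one s hs0 hs1]
  -- (a) the power of `Q`
  have hQ : D.Q ^ (1 - 2 * s.re) = (D.Q ^ 2) ^ (k + 1) := by
    rw [hsre, hσ, show (1 : ℝ) - 2 * (-(k : ℝ) - 1 / 2) = ((2 * (k + 1) : ℕ) : ℝ) by push_cast; ring,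
      Real.rpow_natCast, pow_mul]
  -- (b) `‖F(1 - conj s)‖ ≤ A₀`
  have hF1 : ‖D.toFun (1 - conj s)‖ ≤ A₀ := hFA₀ _ (by simp [hsre, hσ]; linarith)
  -- (c) the Gamma ratios
  obtain ⟨β, hβ⟩ : ∃ β : ℝ, (k : ℝ) + (3 * Sμ + 4) + |t| = β := ⟨_, rfl⟩
  have hβ1 : 1 ≤ β := by rw [← hβ]; linarith [abs_nonneg t]
  have hratio : ∀ j, ‖Gamma (D.lam j * (1 - s) + conj (D.mu j))‖ *
      ‖(Gamma (D.lam j * s + D.mu j))⁻¹‖ ≤ 120 * Real.pi ^ 2 * β ^ (D.lam j * (2 * k + 2) + 2) := by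
    intro j
    have hl := D.lam_pos j
    have hl1 := hlam1 j
    have hμre := D.mu_re_nonneg j
    obtain ⟨X, hX⟩ : ∃ X : ℝ, D.lam j * (k + 3 / 2) + (D.mu j).re = X := ⟨_, rfl⟩
    obtain ⟨Y, hY⟩ : ∃ Y : ℝ, (D.mu j).re - D.lam j * (k + 1 / 2) = Y := ⟨_, rfl⟩
    obtain ⟨u, hu⟩ : ∃ u : ℝ, D.lam j * t + (D.mu j).im = u := ⟨_, rfl⟩
    have hnum : (D.lam j : ℂ) * (1 - s) + conj (D.mu j) = conj ((X : ℂ) + u * I) := by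
      apply Complex.ext
      · rw [re_lam_mul_add, Complex.sub_re, Complex.one_re, hsre, Complex.conj_re]
        simp only [Complex.conj_re, Complex.add_re, Complex.ofReal_re, Complex.mul_re, Complex.I_re,
          Complex.ofReal_im, Complex.I_im, mul_zero, mul_one, sub_self, add_zero]
        rw [← hX, hσ]; ring
      · rw [im_lam_mul_add, Complex.sub_im, Complex.one_im, hsim, Complex.conj_im]
        simp only [Complex.conj_im, Complex.add_im, Complex.ofReal_im, Complex.mul_im, Complex.I_re,
          Complex.ofReal_re, Complex.I_im, mul_zero, mul_one, zero_add, add_zero]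
        rw [← hu]; ring
    have hden : (D.lam j : ℂ) * s + D.mu j = (Y : ℂ) + u * I := by
      apply Complex.ext
      · rw [re_lam_mul_add, hsre]
        simp only [Complex.add_re, Complex.ofReal_re, Complex.mul_re, Complex.I_re, Complex.ofReal_im,
          Complex.I_im, mul_zero, mul_one, sub_self, add_zero]
        rw [← hY, hσ]; ring
      · rw [im_lam_mul_add, hsim]
        simp only [Complex.add_im, Complex.ofReal_im, Complex.mul_im, Complex.I_re, Complex.ofReal_re,
          Complex.I_im, mul_zero, mul_one, zero_add, add_zero]
        rw [← hu]
    have hX1 : 1 ≤ X := by rw [← hX]; nlinarith [hkj j]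
    have hY1 : Y ≤ 1 / 2 := by rw [← hY]; nlinarith [hkj j]
    rw [hnum, Complex.Gamma_conj, Complex.norm_conj, hden]
    refine (norm_Gamma_mul_norm_inv_Gamma_le hX1 hY1 u).trans ?_
    -- `1 + |u| ≤ β`, `X + |Y| + 3 + |u| ≤ β`, `X - Y + 1/2 = λ(2k+2) + 1/2`
    have hμ1 : |(D.mu j).im| ≤ ‖D.mu j‖ := Complex.abs_im_le_norm _
    have hμ2 : |(D.mu j).re| ≤ ‖D.mu j‖ := Complex.abs_re_le_norm _
    have hμ3 := hmuS j
    have hu1 : |u| ≤ |t| + ‖D.mu j‖ := by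
      rw [← hu]
      refine (abs_add_le _ _).trans ?_
      rw [abs_mul, abs_of_pos hl]
      nlinarith [abs_nonneg t]
    have hb1 : 1 + |u| ≤ β := by rw [← hβ]; linarith
    have hXle : X ≤ (k + 3 / 2) / 2 + ‖D.mu j‖ := by
      rw [← hX]; nlinarith [le_abs_self (D.mu j).re]
    have hYle : |Y| ≤ (k + 1 / 2) / 2 + ‖D.mu j‖ := by
      rw [← hY, abs_le]; constructor
      · nlinarith [neg_abs_le (D.mu j).re]
      · nlinarith [le_abs_self (D.mu j).re]
    have hb2 : X + |Y| + 3 + |u| ≤ β := by rw [← hβ]; linarith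
    have hexp : X - Y + 1 / 2 = D.lam j * (2 * k + 2) + 1 / 2 := by rw [← hX, ← hY]; ring
    have hexp0 : 0 ≤ D.lam j * (2 * k + 2) + 1 / 2 := by positivity
    have hb0 : 0 ≤ X + |Y| + 3 + |u| := by linarith [abs_nonneg Y, abs_nonneg u]
    rw [hexp]
    calc 120 * Real.pi ^ 2 * (1 + |u|) ^ (3 / 2 : ℝ) * (X + |Y| + 3 + |u|) ^ (D.lam j * (2 * k + 2) + 1 / 2)
        ≤ 120 * Real.pi ^ 2 * β ^ (3 / 2 : ℝ) * β ^ (D.lam j * (2 * k + 2) + 1 / 2) :=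
          mul_le_mul (mul_le_mul_of_nonneg_left
            (Real.rpow_le_rpow (by linarith [abs_nonneg u]) hb1 (by norm_num)) (by positivity))
            (Real.rpow_le_rpow hb0 hb2 hexp0) (Real.rpow_nonneg hb0 _)
            (mul_nonneg (by positivity) (Real.rpow_nonneg (by linarith) _))
      _ = 120 * Real.pi ^ 2 * β ^ (D.lam j * (2 * k + 2) + 2) := by
          rw [mul_assoc, ← Real.rpow_add (by linarith)]; congr 2; ring
  -- (d) the product of the ratios
  have hprod : (∏ j, (‖Gamma (D.lam j * (1 - s) + conj (D.mu j))‖ *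
      ‖(Gamma (D.lam j * s + D.mu j))⁻¹‖)) ≤
      (120 * Real.pi ^ 2) ^ D.numGamma * β ^ (D.degree * (k + 1) + 2 * D.numGamma) := by
    calc (∏ j, (‖Gamma (D.lam j * (1 - s) + conj (D.mu j))‖ * ‖(Gamma (D.lam j * s + D.mu j))⁻¹‖))
        ≤ ∏ j, (120 * Real.pi ^ 2 * β ^ (D.lam j * (2 * k + 2) + 2)) :=
          Finset.prod_le_prod (fun j _ ↦ by positivity) fun j _ ↦ hratio j
      _ = (120 * Real.pi ^ 2) ^ D.numGamma * β ^ (∑ j, (D.lam j * (2 * k + 2) + 2)) := by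
          rw [Finset.prod_mul_distrib, Finset.prod_const, Finset.card_univ, Fintype.card_fin,
            Real.rpow_sum_of_pos (by linarith)]
      _ = (120 * Real.pi ^ 2) ^ D.numGamma * β ^ (D.degree * (k + 1) + 2 * D.numGamma) := by
          congr 2
          rw [Finset.sum_add_distrib, Finset.sum_const, Finset.card_univ, Fintype.card_fin,
            ← Finset.sum_mul]
          simp only [degree, nsmul_eq_mul]
          ring
  -- assemble (no `rw` in the large goal: real-arithmetic unification is expensive)
  have h0 : 0 ≤ D.Q ^ (1 - 2 * s.re) := (Real.rpow_pos_of_pos D.Q_pos _).le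
  have hβ0 : 0 ≤ β := by linarith
  have hfin : D.Q ^ (1 - 2 * s.re) * (∏ j, (‖Gamma (D.lam j * (1 - s) + conj (D.mu j))‖ *
        ‖(Gamma (D.lam j * s + D.mu j))⁻¹‖)) * ‖D.toFun (1 - conj s)‖ ≤
      D.Q ^ (1 - 2 * s.re) * ((120 * Real.pi ^ 2) ^ D.numGamma *
          β ^ (D.degree * (k + 1) + 2 * D.numGamma)) * A₀ :=
    mul_le_mul (mul_le_mul_of_nonneg_left hprod h0) hF1 (norm_nonneg _)
      (mul_nonneg h0 (mul_nonneg (by positivity) (Real.rpow_nonneg hβ0 _)))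
  have hQ' := congrArg (fun x : ℝ ↦ x * ((120 * Real.pi ^ 2) ^ D.numGamma *
      β ^ (D.degree * (k + 1) + 2 * D.numGamma)) * A₀) hQ
  subst hβ
  calc _ ≤ _ := hfin
    _ = _ := hQ'
    _ = _ := by ring

/-! ## Growth from below on the line `re s = 1/4` -/

/-- **Lower bound on `re s = 1/4` from the functional equation**: for `d < 1` and a gamma factor
`j₀`, there is `R > 0` with
`‖F(1/4 + it)‖ ≥ R (1 + (λ₀t + im μ₀)²/x₀²)^{λ₀/4} ‖F(3/4 + it)‖`, `x₀ = λ₀/4 + re μ₀`, for all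
real `t`: take norms in axiom (iii) at `s = 1/4 + it` (so `1 − s̄ = 3/4 + it`) and bound each
`‖Γ(λⱼ(3/4+it) + μⱼ)‖/‖Γ(λⱼ(1/4+it) + μⱼ)‖` from below by log-convexity
(`Literature.Analysis.SpecialFunctions.norm_Gamma_shift_ge`, shift `δⱼ = λⱼ/2 < 1`), keeping the
growing factor only for `j₀`. [cite: ConreyGhosh1993, §2] -/
theorem exists_norm_toFun_quarter_ge (hd : D.degree < 1) (j₀ : Fin D.numGamma) :
    ∃ R : ℝ, 0 < R ∧ ∀ t : ℝ,
      R * (1 + (D.lam j₀ * t + (D.mu j₀).im) ^ 2 / (D.lam j₀ / 4 + (D.mu j₀).re) ^ 2) ^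
          (D.lam j₀ / 4) * ‖D.toFun (((3 / 4 : ℝ) : ℂ) + t * I)‖ ≤
        ‖D.toFun (((1 / 4 : ℝ) : ℂ) + t * I)‖ := by
  -- the constants `rⱼ = Γ(xⱼ + δⱼ)/Γ(xⱼ)`
  have hx : ∀ j, 0 < D.lam j / 4 + (D.mu j).re := fun j ↦
    add_pos_of_pos_of_nonneg (by linarith [D.lam_pos j]) (D.mu_re_nonneg j)
  have hδ1 : ∀ j, D.lam j / 2 < 1 := fun j ↦ by
    linarith [D.lam_le_degree_div_two j]
  obtain ⟨Rp, hRp⟩ : ∃ R : ℝ, (∏ j, Real.Gamma (D.lam j / 4 + (D.mu j).re + D.lam j / 2) /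
    Real.Gamma (D.lam j / 4 + (D.mu j).re)) = R := ⟨_, rfl⟩
  have hr : ∀ j, 0 < Real.Gamma (D.lam j / 4 + (D.mu j).re + D.lam j / 2) /
      Real.Gamma (D.lam j / 4 + (D.mu j).re) := fun j ↦
    div_pos (Real.Gamma_pos_of_pos (by linarith [hx j, D.lam_pos j])) (Real.Gamma_pos_of_pos (hx j))
  have hRp0 : 0 < Rp := by rw [← hRp]; exact Finset.prod_pos fun j _ ↦ hr j
  refine ⟨D.Q ^ (1 / 2 : ℝ) * Rp, mul_pos (Real.rpow_pos_of_pos D.Q_pos _) hRp0, fun t ↦ ?_⟩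
  -- the functional equation at `s = 1/4 + it`, in norm
  set s : ℂ := ((1 / 4 : ℝ) : ℂ) + t * I with hs
  have hsre : s.re = 1 / 4 := by simp [hs]
  have hsim : s.im = t := by simp [hs]
  have hs' : 1 - conj s = ((3 / 4 : ℝ) : ℂ) + t * I := by
    apply Complex.ext
    · simp [hs]; norm_num
    · simp [hs]
  have hfe := congrArg (fun z ↦ ‖z‖) (D.functional_equation s (by rw [hsre]; norm_num)
    (by rw [hsre]; norm_num))
  simp only [norm_mul, norm_prod, Complex.norm_conj, D.norm_rootNumber, one_mul,
    Complex.norm_cpow_eq_rpow_re_of_pos D.Q_pos, hs'] at hfe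
  rw [hsre] at hfe
  have h34 : (((3 / 4 : ℝ) : ℂ) + t * I).re = 3 / 4 := by simp
  rw [h34] at hfe
  -- each gamma factor: numerator ≥ rⱼ gⱼ · denominator
  have harg : ∀ j, (D.lam j : ℂ) * s + D.mu j = ((D.lam j / 4 + (D.mu j).re : ℝ) : ℂ) +
      (D.lam j * t + (D.mu j).im : ℝ) * I := by
    intro j; apply Complex.ext
    · rw [re_lam_mul_add, hsre]; simp; ring
    · rw [im_lam_mul_add, hsim]; simp
  have harg' : ∀ j, (D.lam j : ℂ) * (((3 / 4 : ℝ) : ℂ) + t * I) + D.mu j =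
      ((D.lam j / 4 + (D.mu j).re + D.lam j / 2 : ℝ) : ℂ) + (D.lam j * t + (D.mu j).im : ℝ) * I := by
    intro j; apply Complex.ext
    · rw [re_lam_mul_add]; simp; ring
    · rw [im_lam_mul_add]; simp
  have hfac : ∀ j, Real.Gamma (D.lam j / 4 + (D.mu j).re + D.lam j / 2) /
      Real.Gamma (D.lam j / 4 + (D.mu j).re) *
      (1 + (D.lam j * t + (D.mu j).im) ^ 2 / (D.lam j / 4 + (D.mu j).re) ^ 2) ^ (D.lam j / 2 / 2) *
      ‖Gamma ((D.lam j : ℂ) * s + D.mu j)‖ ≤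
      ‖Gamma ((D.lam j : ℂ) * (((3 / 4 : ℝ) : ℂ) + t * I) + D.mu j)‖ := by
    intro j
    rw [harg j, harg' j]
    exact norm_Gamma_shift_ge (hx j) (by linarith [D.lam_pos j]) (hδ1 j) _
  -- the growing factors are `≥ 1`
  have hg1 : ∀ j, 1 ≤ (1 + (D.lam j * t + (D.mu j).im) ^ 2 / (D.lam j / 4 + (D.mu j).re) ^ 2) ^
      (D.lam j / 2 / 2) := fun j ↦
    Real.one_le_rpow (le_add_of_nonneg_right (div_nonneg (sq_nonneg _) (sq_nonneg _)))
      (by linarith [D.lam_pos j])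
  -- product of the lower bounds
  have hden0 : ∀ j, 0 < ‖Gamma ((D.lam j : ℂ) * s + D.mu j)‖ := fun j ↦
    norm_pos_iff.2 (D.Gamma_lam_mul_add_mu_ne_zero s (by rw [hsre]; norm_num) j)
  set g : Fin D.numGamma → ℝ := fun j ↦
    (1 + (D.lam j * t + (D.mu j).im) ^ 2 / (D.lam j / 4 + (D.mu j).re) ^ 2) ^ (D.lam j / 2 / 2) with hg
  have hprod : Rp * g j₀ * ∏ j, ‖Gamma ((D.lam j : ℂ) * s + D.mu j)‖ ≤
      ∏ j, ‖Gamma ((D.lam j : ℂ) * (((3 / 4 : ℝ) : ℂ) + t * I) + D.mu j)‖ := by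
    have h1 : ∏ j, (Real.Gamma (D.lam j / 4 + (D.mu j).re + D.lam j / 2) /
        Real.Gamma (D.lam j / 4 + (D.mu j).re) * g j * ‖Gamma ((D.lam j : ℂ) * s + D.mu j)‖) ≤
        ∏ j, ‖Gamma ((D.lam j : ℂ) * (((3 / 4 : ℝ) : ℂ) + t * I) + D.mu j)‖ :=
      Finset.prod_le_prod (fun j _ ↦ by
        have := hr j; have := hg1 j; have := hden0 j; simp only [hg]; positivity) fun j _ ↦ hfac j
    rw [Finset.prod_mul_distrib, Finset.prod_mul_distrib, hRp] at h1
    have h2 : g j₀ ≤ ∏ j, g j := by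
      rw [← Finset.mul_prod_erase Finset.univ g (Finset.mem_univ j₀)]
      have h3 : 1 ≤ ∏ j ∈ Finset.univ.erase j₀, g j := by
        calc (1 : ℝ) = ∏ _j ∈ Finset.univ.erase j₀, (1 : ℝ) := by simp
          _ ≤ ∏ j ∈ Finset.univ.erase j₀, g j :=
              Finset.prod_le_prod (fun _ _ ↦ zero_le_one) fun j _ ↦ hg1 j
      have h4 : 0 ≤ g j₀ := le_trans zero_le_one (hg1 j₀)
      nlinarith
    have hP0 : 0 ≤ ∏ j, ‖Gamma ((D.lam j : ℂ) * s + D.mu j)‖ := Finset.prod_nonneg fun j _ ↦ norm_nonneg _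
    calc Rp * g j₀ * ∏ j, ‖Gamma ((D.lam j : ℂ) * s + D.mu j)‖
        ≤ Rp * (∏ j, g j) * ∏ j, ‖Gamma ((D.lam j : ℂ) * s + D.mu j)‖ := by gcongr
      _ ≤ _ := h1
  -- conclude from `hfe : Q^{1/4} Pden ‖F s‖ = Q^{3/4} Pnum ‖F(3/4+it)‖`
  have hPden : 0 < ∏ j, ‖Gamma ((D.lam j : ℂ) * s + D.mu j)‖ := Finset.prod_pos fun j _ ↦ hden0 j
  have hQ14 : 0 < D.Q ^ (1 / 4 : ℝ) := Real.rpow_pos_of_pos D.Q_pos _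
  have hQ34 : D.Q ^ (3 / 4 : ℝ) = D.Q ^ (1 / 2 : ℝ) * D.Q ^ (1 / 4 : ℝ) := by
    rw [← Real.rpow_add D.Q_pos]; norm_num
  have hF34 : 0 ≤ ‖D.toFun (((3 / 4 : ℝ) : ℂ) + t * I)‖ := norm_nonneg _
  have hQpos : 0 < D.Q := D.Q_pos
  have hQQ : 0 ≤ D.Q ^ (1 / 2 : ℝ) * D.Q ^ (1 / 4 : ℝ) := by positivity
  -- `Q^{1/4} Pden ‖F s‖ ≥ Q^{1/4} Pden · (Q^{1/2} Rp g₀ ‖F(3/4+it)‖)`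
  have key : D.Q ^ (1 / 4 : ℝ) * (∏ j, ‖Gamma ((D.lam j : ℂ) * s + D.mu j)‖) *
      (D.Q ^ (1 / 2 : ℝ) * Rp * g j₀ * ‖D.toFun (((3 / 4 : ℝ) : ℂ) + t * I)‖) ≤
      D.Q ^ (1 / 4 : ℝ) * (∏ j, ‖Gamma ((D.lam j : ℂ) * s + D.mu j)‖) * ‖D.toFun s‖ := by
    rw [hfe, hQ34]
    calc D.Q ^ (1 / 4 : ℝ) * (∏ j, ‖Gamma ((D.lam j : ℂ) * s + D.mu j)‖) *
          (D.Q ^ (1 / 2 : ℝ) * Rp * g j₀ * ‖D.toFun (((3 / 4 : ℝ) : ℂ) + t * I)‖)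
        = D.Q ^ (1 / 2 : ℝ) * D.Q ^ (1 / 4 : ℝ) *
            (Rp * g j₀ * ∏ j, ‖Gamma ((D.lam j : ℂ) * s + D.mu j)‖) *
            ‖D.toFun (((3 / 4 : ℝ) : ℂ) + t * I)‖ := by ring
      _ ≤ D.Q ^ (1 / 2 : ℝ) * D.Q ^ (1 / 4 : ℝ) *
            (∏ j, ‖Gamma ((D.lam j : ℂ) * (((3 / 4 : ℝ) : ℂ) + t * I) + D.mu j)‖) *
            ‖D.toFun (((3 / 4 : ℝ) : ℂ) + t * I)‖ := by gcongr
  have hc : 0 < D.Q ^ (1 / 4 : ℝ) * ∏ j, ‖Gamma ((D.lam j : ℂ) * s + D.mu j)‖ := mul_pos hQ14 hPden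
  have := le_of_mul_le_mul_left key hc
  simpa only [hg, mul_assoc, div_div, show (2 : ℝ) * 2 = 4 by norm_num] using this

end SelbergDatum

/-- The growing factor tends to infinity: `(1 + (lt + c)²/x²)^e → ∞` as `t → ∞`
(`l, x, e > 0`). [folklore] -/
theorem tendsto_one_add_sq_div_rpow_atTop {l c x e : ℝ} (hl : 0 < l) (hx : 0 < x) (he : 0 < e) :
    Tendsto (fun t : ℝ ↦ (1 + (l * t + c) ^ 2 / x ^ 2) ^ e) atTop atTop := by
  have h1 : Tendsto (fun t : ℝ ↦ l * t + c) atTop atTop :=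
    tendsto_atTop_add_const_right _ c (tendsto_id.const_mul_atTop hl)
  have h2 : Tendsto (fun t : ℝ ↦ (l * t + c) ^ 2) atTop atTop :=
    (tendsto_pow_atTop two_ne_zero).comp h1
  have h3 : Tendsto (fun t : ℝ ↦ (l * t + c) ^ 2 / x ^ 2) atTop atTop :=
    h2.atTop_div_const (by positivity)
  have h4 : Tendsto (fun t : ℝ ↦ 1 + (l * t + c) ^ 2 / x ^ 2) atTop atTop :=
    tendsto_atTop_add_const_left _ 1 h3
  exact (tendsto_rpow_atTop he).comp h4

namespace SelbergDatum
end SelbergDatum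

end Literature.NumberTheory.LFunctions
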